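import Literature.Analysis.FluidPDE.WeakSolution
import Summits.NavierStokesRegularity.NavierStokesRegularity.Theorems.MustSqueeze.Negative.GaussianVortex

/-!
# Crux `ForcedSymmetry` (stmt-NavierStokesRegularity-4052), negative side: the symmetry-free Gaussian witness

The explicit field behind `forcedSymmetry_false_without_H3` (file `Negative/WithoutOseen.lean`):
`w t x = e^{t/2} · e^{−‖x‖²} · (rot x + x₀ rot0 x)` — two Gaussian vortices with DIFFERENT axes, the
second weighted by the coordinate `x₀`, driven by the non-self-similar clock `e^{t/2}` — with its
derivatives (`DP`, `DV`, `fderiv_w`, `timeDeriv_w`), coordinate formulae, the pointwise bounds `‖V‖ ≤ 2`,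
`‖DV‖ ≤ 7` and the scale-invariant gradient bound `‖∇w‖ ≤ 7/(−t)` (`w_grad`)
and the special values `P 0 = P (±e₂) = 0`, `P e₀ = e₁` used by the rigidity computation.  Mathlib
content over the toolkit of `MustSqueeze/Negative/GaussianVortex.lean` (`e0`, `e1`, `rot`, `gauss`);
no route declaration is mentioned.  Extracted from the crux work file `Cruxes/ForcedSymmetry/Disproof.lean`
v1 (cdisprove adversary, D-0016).
-/

noncomputable section

namespace Summit.NavierStokesRegularity.NavierStokesRegularity.Theorems.ForcedSymmetry.Negative

open MeasureTheory Set Filter Topology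
open Summit.NavierStokesRegularity.NavierStokesRegularity.Theorems.MustSqueeze.Negative

/-! ### Coordinates of the frame and of the two rotation generators -/

/-- `e₂`. -/
def e2 : EuclideanSpace ℝ (Fin 3) := EuclideanSpace.single 2 1

/-- `e₀ = (1,0,0)`, first coordinate. -/
@[simp] theorem e0_c0 : e0 0 = 1 := by simp [e0]
/-- `e₀ = (1,0,0)`, second coordinate. -/
@[simp] theorem e0_c1 : e0 1 = 0 := by simp [e0]
/-- `e₀ = (1,0,0)`, third coordinate. -/
@[simp] theorem e0_c2 : e0 2 = 0 := by simp [e0]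
/-- `e₁ = (0,1,0)`, first coordinate. -/
@[simp] theorem e1_c0 : e1 0 = 0 := by simp [e1]
/-- `e₁ = (0,1,0)`, second coordinate. -/
@[simp] theorem e1_c1 : e1 1 = 1 := by simp [e1]
/-- `e₁ = (0,1,0)`, third coordinate. -/
@[simp] theorem e1_c2 : e1 2 = 0 := by simp [e1]
/-- `e₂ = (0,0,1)`, first coordinate. -/
@[simp] theorem e2_c0 : e2 0 = 0 := by simp [e2]
/-- `e₂ = (0,0,1)`, second coordinate. -/
@[simp] theorem e2_c1 : e2 1 = 0 := by simp [e2]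
/-- `e₂ = (0,0,1)`, third coordinate. -/
@[simp] theorem e2_c2 : e2 2 = 1 := by simp [e2]

/-- `rot x = (−x₁, x₀, 0)`, first coordinate. -/
@[simp] theorem rot_c0 (x : EuclideanSpace ℝ (Fin 3)) : rot x 0 = - x 1 := (rot_coord x).1
/-- `rot x = (−x₁, x₀, 0)`, second coordinate. -/
@[simp] theorem rot_c1 (x : EuclideanSpace ℝ (Fin 3)) : rot x 1 = x 0 := (rot_coord x).2.1
/-- `rot x = (−x₁, x₀, 0)`, third coordinate. -/
@[simp] theorem rot_c2 (x : EuclideanSpace ℝ (Fin 3)) : rot x 2 = 0 := (rot_coord x).2.2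

/-- The rotation generator about the `e₀`-axis, `rot0 x = e₀ × x = x₁ e₂ − x₂ e₁`. -/
def rot0 : EuclideanSpace ℝ (Fin 3) →L[ℝ] EuclideanSpace ℝ (Fin 3) :=
  (EuclideanSpace.proj (1 : Fin 3) : EuclideanSpace ℝ (Fin 3) →L[ℝ] ℝ).smulRight e2 -
    (EuclideanSpace.proj (2 : Fin 3) : EuclideanSpace ℝ (Fin 3) →L[ℝ] ℝ).smulRight e1

/-- Unfolding `rot0`. -/
theorem rot0_apply (x : EuclideanSpace ℝ (Fin 3)) : rot0 x = x 1 • e2 - x 2 • e1 := rfl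

/-- `rot0 x = (0, −x₂, x₁)`, first coordinate. -/
@[simp] theorem rot0_c0 (x : EuclideanSpace ℝ (Fin 3)) : rot0 x 0 = 0 := by simp [rot0_apply]
/-- `rot0 x = (0, −x₂, x₁)`, second coordinate. -/
@[simp] theorem rot0_c1 (x : EuclideanSpace ℝ (Fin 3)) : rot0 x 1 = - x 2 := by simp [rot0_apply]
/-- `rot0 x = (0, −x₂, x₁)`, third coordinate. -/
@[simp] theorem rot0_c2 (x : EuclideanSpace ℝ (Fin 3)) : rot0 x 2 = x 1 := by simp [rot0_apply]

/-- The coordinate functional `x ↦ x₀`. -/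
def proj0 : EuclideanSpace ℝ (Fin 3) →L[ℝ] ℝ := EuclideanSpace.proj (0 : Fin 3)

/-- Unfolding `proj0`. -/
@[simp] theorem proj0_apply (x : EuclideanSpace ℝ (Fin 3)) : proj0 x = x 0 := rfl

/-- `⟪e_i, v⟫ = v i`. -/
theorem inner_single_one_left (i : Fin 3) (v : EuclideanSpace ℝ (Fin 3)) :
    inner ℝ (EuclideanSpace.single i (1 : ℝ)) v = v i := by
  rw [EuclideanSpace.inner_single_left]; simp

/-- `⟪v, e_i⟫ = v i`. -/
theorem inner_single_one_right (i : Fin 3) (v : EuclideanSpace ℝ (Fin 3)) :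
    inner ℝ v (EuclideanSpace.single i (1 : ℝ)) = v i := by
  rw [EuclideanSpace.inner_single_right]; simp

/-- `⟪e₀, v⟫ = v₀`. -/
@[simp] theorem inner_e0_left (v : EuclideanSpace ℝ (Fin 3)) : inner ℝ e0 v = v 0 := inner_single_one_left 0 v
/-- `⟪e₂, v⟫ = v₂`. -/
@[simp] theorem inner_e2_left (v : EuclideanSpace ℝ (Fin 3)) : inner ℝ e2 v = v 2 := inner_single_one_left 2 v

/-- `|x i| ≤ ‖x‖` on `ℝ³`. -/
theorem abs_coord_le_norm (x : EuclideanSpace ℝ (Fin 3)) (i : Fin 3) : |x i| ≤ ‖x‖ := by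
  simpa [Real.norm_eq_abs] using PiLp.norm_apply_le x i

/-- `‖rot0 x‖ ≤ ‖x‖`. -/
theorem norm_rot0_le (x : EuclideanSpace ℝ (Fin 3)) : ‖rot0 x‖ ≤ ‖x‖ := by
  have h1 : ‖rot0 x‖ ^ 2 = x 2 ^ 2 + x 1 ^ 2 := by
    rw [EuclideanSpace.real_norm_sq_eq, Fin.sum_univ_three, rot0_c0, rot0_c1, rot0_c2]; ring
  have h2 : ‖x‖ ^ 2 = x 0 ^ 2 + x 1 ^ 2 + x 2 ^ 2 := by
    rw [EuclideanSpace.real_norm_sq_eq, Fin.sum_univ_three]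
  have h3 : ‖rot0 x‖ ^ 2 ≤ ‖x‖ ^ 2 := by rw [h1, h2]; nlinarith [sq_nonneg (x 0)]
  exact (pow_le_pow_iff_left₀ (norm_nonneg _) (norm_nonneg _) two_ne_zero).1 h3

/-! ### The polynomial part `P`, the profile `V = gauss • P`, the witness `w = e^{t/2} V` -/

/-- The polynomial part of the witness profile: `P x = rot x + x₀ rot0 x = (−x₁, x₀ − x₀x₂, x₀x₁)`
(two vortices with DIFFERENT axes; the second one weighted by `x₀` to break every rotation). -/
def P (x : EuclideanSpace ℝ (Fin 3)) : EuclideanSpace ℝ (Fin 3) := rot x + x 0 • rot0 x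

/-- `P x = (−x₁, x₀ − x₀x₂, x₀x₁)`, first coordinate. -/
@[simp] theorem P_c0 (x : EuclideanSpace ℝ (Fin 3)) : P x 0 = - x 1 := by simp [P]
/-- `P x = (−x₁, x₀ − x₀x₂, x₀x₁)`, second coordinate. -/
@[simp] theorem P_c1 (x : EuclideanSpace ℝ (Fin 3)) : P x 1 = x 0 - x 0 * x 2 := by simp [P]; ring
/-- `P x = (−x₁, x₀ − x₀x₂, x₀x₁)`, third coordinate. -/
@[simp] theorem P_c2 (x : EuclideanSpace ℝ (Fin 3)) : P x 2 = x 0 * x 1 := by simp [P]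

/-- The Fréchet derivative of `P`: `DP x h = rot h + x₀ rot0 h + h₀ rot0 x`. -/
def DP (x : EuclideanSpace ℝ (Fin 3)) : EuclideanSpace ℝ (Fin 3) →L[ℝ] EuclideanSpace ℝ (Fin 3) :=
  rot + (x 0 • rot0 + proj0.smulRight (rot0 x))

/-- Unfolding `DP`. -/
theorem DP_apply (x h : EuclideanSpace ℝ (Fin 3)) : DP x h = rot h + (x 0 • rot0 h + h 0 • rot0 x) := by
  simp [DP]

/-- `DP x h`, first coordinate. -/
@[simp] theorem DP_c0 (x h : EuclideanSpace ℝ (Fin 3)) : DP x h 0 = - h 1 := by simp [DP_apply]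
/-- `DP x h`, second coordinate. -/
@[simp] theorem DP_c1 (x h : EuclideanSpace ℝ (Fin 3)) : DP x h 1 = h 0 - x 0 * h 2 - h 0 * x 2 := by
  simp [DP_apply]; ring
/-- `DP x h`, third coordinate. -/
@[simp] theorem DP_c2 (x h : EuclideanSpace ℝ (Fin 3)) : DP x h 2 = x 0 * h 1 + h 0 * x 1 := by
  simp [DP_apply]

/-- `P` has derivative `DP`. -/
theorem hasFDerivAt_P (x : EuclideanSpace ℝ (Fin 3)) : HasFDerivAt P (DP x) x := by
  have h1 : HasFDerivAt (fun y : EuclideanSpace ℝ (Fin 3) => y 0) proj0 x := proj0.hasFDerivAt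
  have h2 := h1.smul (rot0.hasFDerivAt (x := x))
  exact rot.hasFDerivAt.add h2

/-- `P` is smooth (a polynomial field). -/
theorem contDiff_P : ContDiff ℝ (⊤ : ℕ∞) P :=
  rot.contDiff.add (proj0.contDiff.smul rot0.contDiff)

/-- `P 0 = 0`. -/
theorem P_zero : P 0 = 0 := by ext i; fin_cases i <;> simp
/-- `P e₀ = e₁`. -/
theorem P_e0 : P e0 = e1 := by ext i; fin_cases i <;> simp
/-- `P e₂ = 0`. -/
theorem P_e2 : P e2 = 0 := by ext i; fin_cases i <;> simp
/-- `P (−e₂) = 0`. -/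
theorem P_neg_e2 : P (-e2) = 0 := by ext i; fin_cases i <;> simp

/-- `‖P x‖ ≤ ‖x‖ + ‖x‖²`. -/
theorem norm_P_le (x : EuclideanSpace ℝ (Fin 3)) : ‖P x‖ ≤ ‖x‖ + ‖x‖ ^ 2 := by
  rw [P]
  calc ‖rot x + x 0 • rot0 x‖ ≤ ‖rot x‖ + ‖x 0 • rot0 x‖ := norm_add_le _ _
    _ = ‖rot x‖ + |x 0| * ‖rot0 x‖ := by rw [norm_smul, Real.norm_eq_abs]
    _ ≤ ‖x‖ + ‖x‖ * ‖x‖ := by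
        gcongr
        · exact norm_rot_le x
        · exact abs_coord_le_norm x 0
        · exact norm_rot0_le x
    _ = ‖x‖ + ‖x‖ ^ 2 := by ring

/-- The witness profile `V x = e^{−‖x‖²} P x`. -/
def V (x : EuclideanSpace ℝ (Fin 3)) : EuclideanSpace ℝ (Fin 3) := gauss x • P x

/-- Its Fréchet derivative. -/
def DV (x : EuclideanSpace ℝ (Fin 3)) : EuclideanSpace ℝ (Fin 3) →L[ℝ] EuclideanSpace ℝ (Fin 3) :=
  gauss x • DP x + ((gauss x * (-2 : ℝ)) • innerSL ℝ x).smulRight (P x)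

/-- `V` has derivative `DV`. -/
theorem hasFDerivAt_V (x : EuclideanSpace ℝ (Fin 3)) : HasFDerivAt V (DV x) x :=
  (hasFDerivAt_gauss x).smul (hasFDerivAt_P x)

/-- Unfolding `DV`: `DV x h = g(x) DP x h − 2 g(x) ⟪x, h⟫ P x`. -/
theorem DV_apply (x h : EuclideanSpace ℝ (Fin 3)) :
    DV x h = gauss x • DP x h + (gauss x * (-2) * inner ℝ x h) • P x := by
  simp only [DV, add_apply, FunLike.coe_smul, Pi.smul_apply,
    ContinuousLinearMap.smulRight_apply, innerSL_apply_apply, smul_eq_mul]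

/-- `V` is smooth. -/
theorem contDiff_V : ContDiff ℝ (⊤ : ℕ∞) V :=
  (Real.contDiff_exp.comp (contDiff_norm_sq ℝ).neg).smul contDiff_P

/-- `V e₀ = e^{-1} e₁` (in particular `V ≠ 0`). -/
theorem V_e0 : V e0 = gauss e0 • e1 := by rw [V, P_e0]

/-- `‖V x‖ ≤ 2` (`g‖x‖ ≤ 1`, `g‖x‖² ≤ 1/2`). -/
theorem norm_V_le (x : EuclideanSpace ℝ (Fin 3)) : ‖V x‖ ≤ 2 := by
  rw [V, norm_smul, Real.norm_eq_abs, abs_of_pos (gauss_pos x)]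
  have h1 := norm_mul_gauss_le_one x
  have h2 := two_mul_norm_sq_mul_gauss_le_one x
  have hg := gauss_pos x
  calc gauss x * ‖P x‖ ≤ gauss x * (‖x‖ + ‖x‖ ^ 2) := by gcongr; exact norm_P_le x
    _ = ‖x‖ * gauss x + ‖x‖ ^ 2 * gauss x := by ring
    _ ≤ 1 + 1 := add_le_add h1 (by linarith)
    _ = 2 := by norm_num

/-- **The drop-H3 witness** `w t x = e^{t/2} e^{−‖x‖²} (rot x + x₀ rot0 x)`. -/
def w (t : ℝ) (x : EuclideanSpace ℝ (Fin 3)) : EuclideanSpace ℝ (Fin 3) := Real.exp (t / 2) • V x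

/-- Derivative of a time slice of the witness. -/
theorem hasFDerivAt_w (t : ℝ) (x : EuclideanSpace ℝ (Fin 3)) :
    HasFDerivAt (w t) (Real.exp (t / 2) • DV x) x :=
  (hasFDerivAt_V x).const_smul (Real.exp (t / 2))

/-- `fderiv` of a time slice of the witness. -/
theorem fderiv_w (t : ℝ) (x : EuclideanSpace ℝ (Fin 3)) : fderiv ℝ (w t) x = Real.exp (t / 2) • DV x :=
  (hasFDerivAt_w t x).fderiv

/-- `d/ds e^{s/2} = e^{s/2}/2`. -/
theorem hasDerivAt_expHalf (t : ℝ) : HasDerivAt (fun s : ℝ => Real.exp (s / 2)) (Real.exp (t / 2) / 2) t := by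
  have h : HasDerivAt (fun s : ℝ => s / 2) (1 / 2 : ℝ) t := by
    simpa using (hasDerivAt_id t).div_const 2
  convert h.exp using 1
  ring

/-- Time derivative of the witness at a fixed point. -/
theorem hasDerivAt_w_time (t : ℝ) (x : EuclideanSpace ℝ (Fin 3)) :
    HasDerivAt (fun s => w s x) ((Real.exp (t / 2) / 2) • V x) t :=
  (hasDerivAt_expHalf t).smul_const (V x)

/-- `∂_t w = (e^{t/2}/2) V`. -/
theorem timeDeriv_w (t : ℝ) (x : EuclideanSpace ℝ (Fin 3)) :
    Literature.Analysis.FluidPDE.timeDeriv w t x = (Real.exp (t / 2) / 2) • V x :=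
  (hasDerivAt_w_time t x).deriv

/-! ### The witness also carries the scale-invariant GRADIENT bound of the drift class -/

/-- `s² e^{−s} ≤ 2` for `s ≥ 0`. -/
theorem sq_mul_exp_neg_le_two {s : ℝ} (hs : 0 ≤ s) : s ^ 2 * Real.exp (-s) ≤ 2 := by
  have h := Real.quadratic_le_exp_of_nonneg hs
  rw [Real.exp_neg, mul_inv_le_iff₀ (Real.exp_pos _)]
  nlinarith

/-- `g ‖x‖³ ≤ 5/4` (AM–GM `‖x‖³ ≤ (‖x‖² + ‖x‖⁴)/2`, `g‖x‖² ≤ 1/2`, `g‖x‖⁴ ≤ 2`). -/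
theorem gauss_mul_norm_cube_le (x : EuclideanSpace ℝ (Fin 3)) : gauss x * ‖x‖ ^ 3 ≤ 5 / 4 := by
  have h1 := two_mul_norm_sq_mul_gauss_le_one x
  have h2 : (‖x‖ ^ 2) ^ 2 * gauss x ≤ 2 := by
    have := sq_mul_exp_neg_le_two (sq_nonneg ‖x‖)
    simpa [gauss] using this
  have hg := gauss_pos x
  have hn := norm_nonneg x
  nlinarith [sq_nonneg (‖x‖ - ‖x‖ ^ 2), mul_nonneg hg.le (sq_nonneg (‖x‖ - ‖x‖ ^ 2))]

/-- Operator-norm bound `‖DP x‖ ≤ 1 + 2‖x‖`. -/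
theorem norm_DP_le (x : EuclideanSpace ℝ (Fin 3)) : ‖DP x‖ ≤ 1 + 2 * ‖x‖ := by
  refine ContinuousLinearMap.opNorm_le_bound _ (by positivity) fun h => ?_
  rw [DP_apply]
  calc ‖rot h + (x 0 • rot0 h + h 0 • rot0 x)‖ ≤ ‖rot h‖ + (‖x 0 • rot0 h‖ + ‖h 0 • rot0 x‖) :=
        (norm_add_le _ _).trans (add_le_add le_rfl (norm_add_le _ _))
    _ = ‖rot h‖ + (|x 0| * ‖rot0 h‖ + |h 0| * ‖rot0 x‖) := by rw [norm_smul, norm_smul, Real.norm_eq_abs, Real.norm_eq_abs]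
    _ ≤ ‖h‖ + (‖x‖ * ‖h‖ + ‖h‖ * ‖x‖) := by
        gcongr
        · exact norm_rot_le h
        · exact abs_coord_le_norm x 0
        · exact norm_rot0_le h
        · exact abs_coord_le_norm h 0
        · exact norm_rot0_le x
    _ = (1 + 2 * ‖x‖) * ‖h‖ := by ring

/-- Operator-norm bound `‖DV x‖ ≤ 7`. -/
theorem norm_DV_le (x : EuclideanSpace ℝ (Fin 3)) : ‖DV x‖ ≤ 7 := by
  have hg := gauss_pos x
  have hn := norm_nonneg x
  have h1 := norm_mul_gauss_le_one x
  have h2 := two_mul_norm_sq_mul_gauss_le_one x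
  have h3 := gauss_mul_norm_cube_le x
  have hgl := gauss_le_one x
  refine ContinuousLinearMap.opNorm_le_bound _ (by norm_num) fun h => ?_
  rw [DV_apply]
  calc ‖gauss x • DP x h + (gauss x * -2 * inner ℝ x h) • P x‖
      ≤ ‖gauss x • DP x h‖ + ‖(gauss x * -2 * inner ℝ x h) • P x‖ := norm_add_le _ _
    _ = gauss x * ‖DP x h‖ + 2 * gauss x * |inner ℝ x h| * ‖P x‖ := by
        rw [norm_smul, norm_smul, Real.norm_eq_abs, Real.norm_eq_abs, abs_of_pos hg, abs_mul, abs_mul,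
          abs_of_pos hg, abs_neg, abs_two]
        ring
    _ ≤ gauss x * ((1 + 2 * ‖x‖) * ‖h‖) + 2 * gauss x * (‖x‖ * ‖h‖) * (‖x‖ + ‖x‖ ^ 2) := by
        gcongr
        · exact (DP x).le_of_opNorm_le (norm_DP_le x) h
        · exact abs_real_inner_le_norm x h
        · exact norm_P_le x
    _ = (gauss x + 2 * (‖x‖ * gauss x) + (2 * (‖x‖ ^ 2 * gauss x)) + 2 * (gauss x * ‖x‖ ^ 3)) * ‖h‖ := by ring
    _ ≤ (1 + 2 * 1 + 1 + 2 * (5 / 4)) * ‖h‖ := by gcongr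
    _ ≤ 7 * ‖h‖ := by nlinarith [norm_nonneg h]

/-- The witness obeys the scale-invariant gradient bound `‖∇w(t,x)‖ ≤ 7/(−t)` of the Type-I DRIFT class
(the hypothesis class of the sister crux `FiniteTangentModuli`): `‖∇w‖ ≤ 7e^{t/2} ≤ 7/(−t)`. -/
theorem w_grad (t : ℝ) (ht : t < 0) (x : EuclideanSpace ℝ (Fin 3)) : ‖fderiv ℝ (w t) x‖ ≤ 7 / (-t) := by
  have ht' : 0 < -t := by linarith
  rw [fderiv_w, norm_smul, Real.norm_eq_abs, abs_of_pos (Real.exp_pos _), le_div_iff₀ ht']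
  have h1 : (-t) * Real.exp (t / 2) ≤ 1 := by
    have := mul_exp_neg_half_le_one ht'.le
    simpa [neg_neg, neg_div] using this
  calc Real.exp (t / 2) * ‖DV x‖ * -t = ((-t) * Real.exp (t / 2)) * ‖DV x‖ := by ring
    _ ≤ 1 * 7 := mul_le_mul h1 (norm_DV_le x) (norm_nonneg _) zero_le_one
    _ = 7 := by norm_num

end Summit.NavierStokesRegularity.NavierStokesRegularity.Theorems.ForcedSymmetry.Negative
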